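import Mathlib
import Summits.Ventures.HodgeRepro.Tier4.Common.AdelicDefs
import Summits.Ventures.HodgeRepro.Tier4.Common.CompactOpenLevel
import Summits.Ventures.HodgeRepro.Tier4.Line1.FiniteLevelIsolation
import Summits.Ventures.HodgeRepro.Tier4.Common.PlaceCommute

/-!
# Tier4/Line4/SupportChoice — C-L4-SUPPCHOICE: the support choices put the convolved projected pair inside the
isolating double coset (the glue between the projected supports and the binder `hF` of L4 v0.28 (xii))

Blind re-derivation cell `pub-hodge-repro`, Tier 4 «prove the step» (README §9–§10), seat t4-L4-p2 (prover, LINE L4,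
gen 3; plan-4 g3's cut S14295, statements VERBATIM from proofs/t4-plan-4/work/SupportChoice-STATEMENTS.lean
fe8cd285a960f337 · 50 — only this header replaced). Tree path `lean/Summits/Ventures/HodgeRepro/Tier4/Line4/SupportChoice.lean`.
Mathlib-level (pointwise set algebra in `G(𝔸_k)`, the commutation of `G_∞` with `G(𝔸_f)` componentwise); no literature.

* `mul_comm_of_mem_infinitePart_of_mem_finitePart` — `x ∈ G_∞`, `y ∈ G(𝔸_f)` commute (`GA.ext_of_components`: at an
  infinite place the `y`-component is `1`, at a finite place the `x`-component is `1`);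
* `set_mul_comm_of_subset_infinitePart` — `A · K = K · A` for `A ⊆ G_∞`, `K ≤ G(𝔸_f)`;
* **`mul_doubleCoset_subset_of_choices`** — `(T K)(Ω₀ γ₀ K)(T K)(Ω₀′ K)(T K) ⊆ (Ω K) γ₀ (Ω K)` with
  `Ω := T Ω₀ ∪ T Ω₀′ T` (every `K` commuted to the right of the archimedean factors, `K K ⊆ K`);
* `isCompact_union_mul_of_choices`, `union_mul_subset_infinitePart_of_choices` — `Ω` compact and archimedean.
Consumer (plan-4, v0.29/v0.30): `T := archTorus' W`, `K := levelK W N`, `tsupport f ⊆ Ω₀ γ₀ K`, `tsupport f' ⊆ Ω₀′ K`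
give `hF` and ISOLPROJ-DC's `hΩc`, `hΩ`.

Nothing here says anything about the status of the Hodge conjecture for CM abelian varieties, which is NOT proved
(HC_CM is NOT proved by anyone in this repository).
-/

set_option autoImplicit false
noncomputable section
namespace Summit.Ventures.HodgeRepro.Tier4.Line4
open Summit.Ventures.HodgeRepro.Tier4.Common Summit.Ventures.HodgeRepro.Tier4.Line1 NumberField
open scoped Pointwise

variable {k : Type} [Field k] [NumberField k] (W : PlaneData k)

/-- **Elements of `G_∞` commute with elements of `G(𝔸_f)`** (componentwise: the infinite part of one and the finite
part of the other are trivial). -/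
theorem mul_comm_of_mem_infinitePart_of_mem_finitePart {x y : GA W} (hx : x ∈ infinitePart W)
    (hy : y ∈ finitePart W) : x * y = y * x := by
  -- the finite components of `x` are trivial
  have hxf : ∀ v : IsDedekindDomain.HeightOneSpectrum (𝓞 k), GA.finiteComponent W v x = 1 := by
    intro v
    apply Units.ext
    apply Matrix.ext
    intro i j
    have h : finPart k (GA.mat W x i j) = (1 : Matrix (Fin 4) (Fin 4) (IsDedekindDomain.FiniteAdeleRing (𝓞 k) k)) i j :=
      congrFun (congrFun hx i) j
    rw [GA.finiteComponent_apply]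
    change RestrictedProduct.evalRingHom (fun v : IsDedekindDomain.HeightOneSpectrum (𝓞 k) => v.adicCompletion k) v
      (finPart k (GA.mat W x i j)) = (1 : Matrix (Fin 4) (Fin 4) (v.adicCompletion k)) i j
    rw [h]
    simp only [Matrix.one_apply]
    split_ifs
    · exact map_one _
    · exact map_zero _
  apply GA.ext_of_components
  · intro w
    rw [map_mul, map_mul, hy w, mul_one, one_mul]
  · intro v
    rw [map_mul, map_mul, hxf v, one_mul, mul_one]

/-- **A subset of `G_∞` commutes with a subgroup of `G(𝔸_f)`, as sets.** -/
theorem set_mul_comm_of_subset_infinitePart {A : Set (GA W)} (hA : A ⊆ (infinitePart W : Set (GA W)))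
    {K : Subgroup (GA W)} (hK : K ≤ finitePart W) : A * (K : Set (GA W)) = (K : Set (GA W)) * A := by
  ext x
  constructor
  · rintro ⟨a, ha, κ, hκ, rfl⟩
    exact ⟨κ, hκ, a, ha, (mul_comm_of_mem_infinitePart_of_mem_finitePart W (hA ha) (hK hκ)).symm⟩
  · rintro ⟨κ, hκ, a, ha, rfl⟩
    exact ⟨a, ha, κ, hκ, mul_comm_of_mem_infinitePart_of_mem_finitePart W (hA ha) (hK hκ)⟩

/-- **The support choices put the convolved projected pair inside the isolating double coset**: with the
saturation `C = T · K` (`T ⊆ G_∞` — the product of the local tori; `K ≤ G(𝔸_f)`), a first test function supported in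
`Ω₀ γ₀ K` and a second in `Ω₀′ K` (`Ω₀, Ω₀′ ⊆ G_∞`), the set `C · (Ω₀ γ₀ K) · C · (Ω₀′ K) · C` lies in
`(Ω K) γ₀ (Ω K)` for `Ω := T Ω₀ ∪ T Ω₀′ T` — compact when `T`, `Ω₀`, `Ω₀′` are, and inside `G_∞`. -/
theorem mul_doubleCoset_subset_of_choices (K : Subgroup (GA W)) (hK : K ≤ finitePart W)
    (T Ω₀ Ω₀' : Set (GA W)) (hT : T ⊆ (infinitePart W : Set (GA W)))
    (hΩ₀ : Ω₀ ⊆ (infinitePart W : Set (GA W))) (hΩ₀' : Ω₀' ⊆ (infinitePart W : Set (GA W))) (γ₀ : GA W) :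
    (T * (K : Set (GA W))) * (Ω₀ * {γ₀} * (K : Set (GA W))) * (T * (K : Set (GA W))) *
        (Ω₀' * (K : Set (GA W))) * (T * (K : Set (GA W))) ⊆
      ((T * Ω₀ ∪ T * Ω₀' * T) * (K : Set (GA W))) * {γ₀} * ((T * Ω₀ ∪ T * Ω₀' * T) * (K : Set (GA W))) := by
  have comm : ∀ {x y : GA W}, x ∈ (infinitePart W : Set (GA W)) → y ∈ K → x * y = y * x :=
    fun hx hy => mul_comm_of_mem_infinitePart_of_mem_finitePart W hx (hK hy)
  intro x hx
  obtain ⟨x₁, hx₁, _, ⟨t₃, ht₃, k₅, hk₅, rfl⟩, rfl⟩ := hx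
  obtain ⟨x₂, hx₂, _, ⟨ω₀', hω₀', k₄, hk₄, rfl⟩, rfl⟩ := hx₁
  obtain ⟨x₃, hx₃, _, ⟨t₂, ht₂, k₃, hk₃, rfl⟩, rfl⟩ := hx₂
  obtain ⟨_, ⟨t₁, ht₁, k₁, hk₁, rfl⟩, og, hog, rfl⟩ := hx₃
  obtain ⟨_, ⟨ω₀, hω₀, g, hg, rfl⟩, k₂, hk₂, rfl⟩ := hog
  refine ⟨t₁ * ω₀ * k₁ * g, ⟨t₁ * ω₀ * k₁, ⟨t₁ * ω₀, Or.inl ⟨t₁, ht₁, ω₀, hω₀, rfl⟩, k₁, hk₁, rfl⟩, g, hg, rfl⟩,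
    t₂ * ω₀' * t₃ * (k₂ * k₃ * k₄ * k₅),
    ⟨t₂ * ω₀' * t₃, Or.inr ⟨t₂ * ω₀', ⟨t₂, ht₂, ω₀', hω₀', rfl⟩, t₃, ht₃, rfl⟩, k₂ * k₃ * k₄ * k₅,
      K.mul_mem (K.mul_mem (K.mul_mem hk₂ hk₃) hk₄) hk₅, rfl⟩, ?_⟩
  -- the commutations: `k₁ ω₀ = ω₀ k₁`, `k₂ t₂ = t₂ k₂`, `(k₂ k₃) ω₀′ = ω₀′ (k₂ k₃)`, `(k₂ k₃ k₄) t₃ = t₃ (k₂ k₃ k₄)`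
  have c₁ : ω₀ * k₁ = k₁ * ω₀ := comm (hΩ₀ hω₀) hk₁
  have c₂ : t₂ * k₂ = k₂ * t₂ := comm (hT ht₂) hk₂
  have c₃ : ω₀' * (k₂ * k₃) = k₂ * k₃ * ω₀' := comm (hΩ₀' hω₀') (K.mul_mem hk₂ hk₃)
  have c₄ : t₃ * (k₂ * k₃ * k₄) = k₂ * k₃ * k₄ * t₃ := comm (hT ht₃) (K.mul_mem (K.mul_mem hk₂ hk₃) hk₄)
  calc t₁ * ω₀ * k₁ * g * (t₂ * ω₀' * t₃ * (k₂ * k₃ * k₄ * k₅))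
      = t₁ * (ω₀ * k₁) * g * (t₂ * (ω₀' * (t₃ * (k₂ * k₃ * k₄))) * k₅) := by simp only [mul_assoc]
    _ = t₁ * (k₁ * ω₀) * g * (t₂ * (ω₀' * (k₂ * k₃ * k₄ * t₃)) * k₅) := by rw [c₁, c₄]
    _ = t₁ * (k₁ * ω₀) * g * (t₂ * ((ω₀' * (k₂ * k₃)) * k₄ * t₃) * k₅) := by simp only [mul_assoc]
    _ = t₁ * (k₁ * ω₀) * g * (t₂ * (k₂ * k₃ * ω₀' * k₄ * t₃) * k₅) := by rw [c₃]
    _ = t₁ * (k₁ * ω₀) * g * ((t₂ * k₂) * (k₃ * ω₀' * k₄ * t₃) * k₅) := by simp only [mul_assoc]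
    _ = t₁ * (k₁ * ω₀) * g * ((k₂ * t₂) * (k₃ * ω₀' * k₄ * t₃) * k₅) := by rw [c₂]
    _ = t₁ * k₁ * (ω₀ * g * k₂) * (t₂ * k₃) * (ω₀' * k₄) * (t₃ * k₅) := by simp only [mul_assoc]

/-- `Ω := T Ω₀ ∪ T Ω₀′ T` is compact and archimedean when its factors are. -/
theorem isCompact_union_mul_of_choices {T Ω₀ Ω₀' : Set (GA W)} (hTc : IsCompact T) (h₀ : IsCompact Ω₀)
    (h₀' : IsCompact Ω₀') : IsCompact (T * Ω₀ ∪ T * Ω₀' * T) :=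
  (hTc.mul h₀).union ((hTc.mul h₀').mul hTc)

/-- `Ω := T Ω₀ ∪ T Ω₀′ T` lies in `G_∞` when its factors do (docstring added by the prover; statement verbatim). -/
theorem union_mul_subset_infinitePart_of_choices {T Ω₀ Ω₀' : Set (GA W)}
    (hT : T ⊆ (infinitePart W : Set (GA W))) (hΩ₀ : Ω₀ ⊆ (infinitePart W : Set (GA W)))
    (hΩ₀' : Ω₀' ⊆ (infinitePart W : Set (GA W))) :
    T * Ω₀ ∪ T * Ω₀' * T ⊆ (infinitePart W : Set (GA W)) := by
  refine Set.union_subset ?_ ?_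
  · exact Set.mul_subset_iff.2 fun a ha b hb => (infinitePart W).mul_mem (hT ha) (hΩ₀ hb)
  · refine Set.mul_subset_iff.2 fun a ha b hb => (infinitePart W).mul_mem ?_ (hT hb)
    obtain ⟨a₁, ha₁, a₂, ha₂, rfl⟩ := ha
    exact (infinitePart W).mul_mem (hT ha₁) (hΩ₀' ha₂)

end Summit.Ventures.HodgeRepro.Tier4.Line4
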